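import Literature.NumberTheory.IwasawaTheory.FukudaGroupLayers
import HarnessLib

/-!
# Fukuda's Theorem 1 at finite level — the COINVARIANT layer quotient: `N_j·P_j·⁅G_i, G_j⁆ ∩ A ⊆ ν_j Y₀ + pA + (φ^{p^i} − 1)A`, hence
# `#(A/(ν_j Y₀ + pA + (φ^{p^i} − 1)A)) ≤ [G_j : N_j·P_j·⁅G_i, G_j⁆]` (group-theoretic brick of door L12 of the cell `bsd-potss`; proved)

Topic `NumberTheory/IwasawaTheory` (namespace `Literature.NumberTheory.IwasawaTheory.FukudaGroup`). THEOREM-ONLY file (no definition,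
no named fact, no `sorry`), written by the prover seat `bsd-potss-k9-c4` g26 (cell `bsd-potss`; `μ`-roads of the record lane of
stmt-BirchSwinnertonDyer-19197; closes nothing).  Sequel of `FukudaGroupLayers` (k8t-c4 g20: `N_j·P_j = (ν_j Y₀ + pA)·⟨g^{p^j}⟩`) in the same
abstract setting (`G` finite, `A ◁ G` abelian, `⟨g⟩ ∩ A = 1`, `A⟨g⟩ = G`, `[G : A] = p^t`, `𝓘` the «inertia» family, `φ = conjEnd A g`,
`Y₀ = subOf A (G'·⟨I⟩)`, `ν_j = ∑_{i<p^j} φ^i`, `G_j ⊇ A` the subgroup of index `p^j`, `N_j = G_j'·⟨I ∩ G_j⟩`, `P_j = ⟨x^p : x ∈ G_j⟩`).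

RESULTS.
* `commutator_sup_zpowers_pow_le` — **`⁅A⟨g^{p^i}⟩, A⟨g^{p^i}⟩⁆ ⊆ (φ^{p^i} − 1)A`** (Washington Lemma 13.15 «`𝒢̃' = (σ−1)X`» for the
  subgroup `G_i = A⟨g^{p^i}⟩`: `⁅a g^{p^i k}, b g^{p^i l}⁆ = (φ^{p^i k} − 1)b − (φ^{p^i l} − 1)a`, `FukudaGroup.commutatorElement_eq`).
* `commutator_sup_layer_pow_sup_commutator_inf_le` — for `i ≤ j ≤ t`: **`(N_j·P_j·⁅G_i, G_j⁆) ∩ A ⊆ ν_j Y₀ + pA + (φ^{p^i} − 1)A`**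
  (with `N_j·P_j = (ν_jY₀ + pA)·⟨g^{p^j}⟩`, `commutator_sup_layer_pow_eq`, and `⟨g^{p^j}⟩ ∩ A = 1`).
* `card_quotient_le_relIndex_commutator_sup_layer_pow_sup_commutator` — **`#(A/(ν_j Y₀ + pA + (φ^{p^i} − 1)A)) ≤ [G_j : N_j·P_j·⁅G_i, G_j⁆]`**.
In the arithmetic application (`G = Gal(H_p(K_{n+t})/K_n)`) the right side is the order of the quotient of `G_j` cut out by the maximal
sub-extension of `H_p/K_{n+j}` that is unramified, elementary abelian AND abelian over `K_{n+i}` — the «genus part» — which class field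
theory bounds by the `Gal(K_{n+j}/K_{n+i})`-coinvariants of `Cl(K_{n+j})/p` (`UnramifiedElementaryCoinvariantModP`); the left side is
`dim X̄/T^{p^i}X̄` at finite level when `i < j` (`FukudaCoinvariantAlgebra`).

References: [Washington1997] L. Washington, *Introduction to Cyclotomic Fields*, 2nd ed., §13.3 Lemmas 13.14–13.18, Prop. 13.22;
[Fukuda1994] T. Fukuda, Proc. Japan Acad. 70 A (1994), Thm. 1 and its proof, p. 264; [Lang1990] S. Lang, *Cyclotomic Fields I and II*,
Ch. 13 §4 (genus theory in `ℤ_p`-extensions).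
-/

noncomputable section

open Subgroup Finset
open scoped IsMulCommutative commutatorElement

namespace Literature.NumberTheory.IwasawaTheory.FukudaGroup

variable {G : Type*} [Group G] (A : Subgroup G) [A.Normal] [IsMulCommutative A]

/-! ## §1 Plumbing for `conjEnd`, `liftSub` (re-proved: the versions of bricks (G)/Layers are private) -/

/-- Unfolding `conjEnd`: `conjEnd A g (ofMul a) = ofMul (g a g⁻¹)`. [folklore] -/
private theorem coe_toMul_conjEnd'' (g : G) (x : Additive A) :
    ((Additive.toMul (conjEnd A g x) : A) : G) = g * (Additive.toMul x : A) * g⁻¹ := rfl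

/-- `conjEnd` is multiplicative in `g`. [folklore] -/
private theorem conjEnd_mul'' (g h : G) : conjEnd A (g * h) = conjEnd A g * conjEnd A h := by
  apply LinearMap.ext; intro x
  apply Additive.toMul.injective; apply Subtype.ext
  simp only [coe_toMul_conjEnd'', Module.End.mul_apply, mul_inv_rev, mul_assoc]

/-- `conjEnd A 1 = 1`. [folklore] -/
private theorem conjEnd_one'' : conjEnd A (1 : G) = 1 := by
  apply LinearMap.ext; intro x
  apply Additive.toMul.injective; apply Subtype.ext
  simp only [coe_toMul_conjEnd'', one_mul, inv_one, mul_one, Module.End.one_apply]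

/-- `conjEnd A (g ^ n) = (conjEnd A g) ^ n`. [folklore] -/
private theorem conjEnd_pow'' (g : G) (n : ℕ) : conjEnd A (g ^ n) = conjEnd A g ^ n := by
  induction n with
  | zero => rw [pow_zero, pow_zero, conjEnd_one'']
  | succ n ih => rw [pow_succ, conjEnd_mul'', ih, pow_succ]

omit [A.Normal] in
/-- Membership in `liftSub`. [folklore] -/
private theorem mem_liftSub'' {S : Submodule ℤ (Additive A)} {x : G} :
    x ∈ liftSub A S ↔ ∃ y : A, Additive.ofMul y ∈ S ∧ (y : G) = x := by
  constructor
  · rintro ⟨y, hy, rfl⟩; exact ⟨y, hy, rfl⟩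
  · rintro ⟨y, hy, rfl⟩; exact ⟨y, hy, rfl⟩

omit [A.Normal] in
/-- `toMul x ∈ liftSub S ↔ x ∈ S`. [folklore] -/
private theorem toMul_mem_liftSub_iff' {S : Submodule ℤ (Additive A)} (x : Additive A) :
    ((Additive.toMul x : A) : G) ∈ liftSub A S ↔ x ∈ S := by
  rw [mem_liftSub'']
  constructor
  · rintro ⟨y', hy', h⟩
    have : y' = Additive.toMul x := Subtype.ext h
    rwa [this, ofMul_toMul] at hy'
  · intro h; exact ⟨Additive.toMul x, by rwa [ofMul_toMul], rfl⟩

omit [A.Normal] in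
/-- `liftSub S ≤ A`. [folklore] -/
private theorem liftSub_le'' (S : Submodule ℤ (Additive A)) : liftSub A S ≤ A := by
  rintro x hx
  obtain ⟨y, -, rfl⟩ := (mem_liftSub'' A).mp hx
  exact y.2

omit [A.Normal] in
/-- `#liftSub S = #S`. [folklore] -/
private theorem card_liftSub'' (S : Submodule ℤ (Additive A)) : Nat.card (liftSub A S) = Nat.card S := by
  rw [liftSub, Subgroup.card_map_of_injective (Subgroup.subtype_injective A)]
  exact Nat.card_congr (Equiv.subtypeEquiv Additive.ofMul fun _ => Iff.rfl)

omit [A.Normal] in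
/-- `liftSub` is monotone. [folklore] -/
private theorem liftSub_mono' {S T : Submodule ℤ (Additive A)} (h : S ≤ T) : liftSub A S ≤ liftSub A T := by
  intro x hx
  obtain ⟨y, hy, rfl⟩ := (mem_liftSub'' A).mp hx
  exact (mem_liftSub'' A).mpr ⟨y, h hy, rfl⟩

section Layers

variable {A} [Finite G] {p : ℕ} [hp : Fact p.Prime]

omit [IsMulCommutative A] hp in
/-- Every element of `A ⊔ ⟨h⟩` is `a h^n` with `a ∈ A`, `n ∈ ℕ` (finite group). [folklore] -/
private theorem exists_eq_mul_pow_of_mem' {h x : G} (hx : x ∈ A ⊔ Subgroup.zpowers h) :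
    ∃ a : A, ∃ n : ℕ, x = (a : G) * h ^ n := by
  rw [Subgroup.mem_sup_of_normal_left] at hx
  obtain ⟨y, hy, z, hz, rfl⟩ := hx
  rw [← mem_powers_iff_mem_zpowers] at hz
  obtain ⟨n, rfl⟩ := hz
  exact ⟨⟨y, hy⟩, n, rfl⟩

omit hp in
/-- `liftSub S` is normal when `S` is `φ`-stable, `φ` = conjugation by a generator `g` of `G` modulo `A`. [folklore] -/
private theorem liftSub_normal' {g : G} (hgen : A ⊔ Subgroup.zpowers g = ⊤) {S : Submodule ℤ (Additive A)}
    (hS : ∀ y ∈ S, conjEnd A g y ∈ S) : (liftSub A S).Normal := by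
  have hSpow : ∀ n : ℕ, ∀ y ∈ S, (conjEnd A g ^ n) y ∈ S := by
    intro n
    induction n with
    | zero => intro y hy; simpa using hy
    | succ n ih => intro y hy; rw [pow_succ', Module.End.mul_apply]; exact hS _ (ih y hy)
  refine ⟨fun l hl x => ?_⟩
  obtain ⟨y, hy, rfl⟩ := (mem_liftSub'' A).mp hl
  obtain ⟨a, n, rfl⟩ := exists_eq_mul_pow_of_mem' (A := A) (by rw [hgen]; exact Subgroup.mem_top x)
  have h1 : g ^ n * (y : G) * (g ^ n)⁻¹ ∈ liftSub A S := by
    have h2 : ((Additive.toMul ((conjEnd A g ^ n) (Additive.ofMul y)) : A) : G) = g ^ n * y * (g ^ n)⁻¹ := by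
      rw [← conjEnd_pow'', coe_toMul_conjEnd'', toMul_ofMul]
    rw [← h2]
    exact (toMul_mem_liftSub_iff' A _).mpr (hSpow n _ hy)
  have h2 : (a : G) * (g ^ n * y * (g ^ n)⁻¹) * (a : G)⁻¹ = g ^ n * y * (g ^ n)⁻¹ := by
    rw [setLike_mul_comm a.2 (liftSub_le'' A _ h1), mul_inv_cancel_right]
  rw [show (a : G) * g ^ n * ↑y * ((a : G) * g ^ n)⁻¹ = (a : G) * (g ^ n * y * (g ^ n)⁻¹) * (a : G)⁻¹ by group, h2]
  exact h1

omit [A.Normal] [Finite G] hp in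
/-- `T ∩ A = liftSub S` for `T = liftSub S ⊔ ⟨h⟩` whenever `⟨h⟩ ∩ A = 1` and `liftSub S` is normal. [folklore] -/
private theorem liftSub_sup_zpowers_inf_eq' {h : G} (hhA : Subgroup.zpowers h ⊓ A = ⊥) (S : Submodule ℤ (Additive A))
    [(liftSub A S).Normal] : (liftSub A S ⊔ Subgroup.zpowers h) ⊓ A = liftSub A S := by
  apply le_antisymm
  · intro x hx
    obtain ⟨hxT, hxA⟩ := Subgroup.mem_inf.mp hx
    rw [Subgroup.mem_sup_of_normal_left] at hxT
    obtain ⟨l, hl, z, hz, rfl⟩ := hxT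
    have hzA : z ∈ A := by
      have h1 := A.mul_mem (A.inv_mem (liftSub_le'' A _ hl)) hxA
      rwa [inv_mul_cancel_left] at h1
    have hz1 : z = 1 := by
      have hmem : z ∈ Subgroup.zpowers h ⊓ A := ⟨hz, hzA⟩
      rwa [hhA, Subgroup.mem_bot] at hmem
    rw [hz1, mul_one]
    exact hl
  · exact le_inf le_sup_left (liftSub_le'' A _)

omit [A.Normal] [IsMulCommutative A] [Finite G] hp in
/-- `[K : T] · #(T ∩ A) = #A` whenever `A ◁ G`, `T, A ≤ K` and `A ⊔ T = K` (re-proved from brick (G), where it is private). [folklore] -/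
private theorem relIndex_mul_card_inf_eq'' [A.Normal] [Finite G] {T K : Subgroup G} (hT : T ≤ K) (hAK : A ≤ K) (hsup : A ⊔ T = K) :
    T.relIndex K * Nat.card ↥(T ⊓ A) = Nat.card A := by
  have h1 : A.relIndex K = A.relIndex T := by rw [← hsup, sup_comm, Subgroup.relIndex_sup_right]
  have hA : A.relIndex K * Nat.card A = Nat.card K := by
    rw [Subgroup.relIndex, mul_comm, ← Nat.card_congr (Subgroup.subgroupOfEquivOfLe hAK).toEquiv, Subgroup.card_mul_index]
  have hTK : T.relIndex K * Nat.card T = Nat.card K := by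
    rw [Subgroup.relIndex, mul_comm, ← Nat.card_congr (Subgroup.subgroupOfEquivOfLe hT).toEquiv, Subgroup.card_mul_index]
  have hTA : A.relIndex T * Nat.card ↥(T ⊓ A) = Nat.card T := by
    rw [Subgroup.relIndex, mul_comm, ← Subgroup.inf_subgroupOf_left,
      ← Nat.card_congr (Subgroup.subgroupOfEquivOfLe (inf_le_left : T ⊓ A ≤ T)).toEquiv, Subgroup.card_mul_index]
  have hpos : 0 < A.relIndex T := Nat.pos_of_ne_zero (by rw [Subgroup.relIndex]; exact Subgroup.index_ne_zero_of_finite)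
  have key : A.relIndex T * (T.relIndex K * Nat.card ↥(T ⊓ A)) = A.relIndex T * Nat.card A := by
    calc A.relIndex T * (T.relIndex K * Nat.card ↥(T ⊓ A))
        = T.relIndex K * (A.relIndex T * Nat.card ↥(T ⊓ A)) := by ring
      _ = T.relIndex K * Nat.card T := by rw [hTA]
      _ = Nat.card K := hTK
      _ = A.relIndex K * Nat.card A := hA.symm
      _ = A.relIndex T * Nat.card A := by rw [h1]
  exact Nat.eq_of_mul_eq_mul_left hpos key

variable {g : G} {𝓘 : Set (Subgroup G)} {t : ℕ}

/-! ## §2 The commutator subgroup of a layer: `⁅A⟨u⟩, A⟨u⟩⁆ ⊆ (φ_u − 1)A` -/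

omit hp in
/-- **`⁅A⟨g^{p^i}⟩, A⟨g^{p^i}⟩⁆ ⊆ (φ^{p^i} − 1)A`** (`φ = conjEnd A g`): for `a, b ∈ A`, `⁅a g^{p^i k}, b g^{p^i l}⁆ = (φ^{p^i k} − 1)b − (φ^{p^i l} − 1)a`
(`FukudaGroup.commutatorElement_eq`) and `φ^{p^i k} − 1 = (∑_{m<k} φ^{p^i m})(φ^{p^i} − 1)`.  Washington's «`𝒢̃' = (σ−1)X`» (Lemma 13.15) for the
subgroup `G_i = A⟨g^{p^i}⟩`. [cite: Washington1997, §13.3 Lemma 13.15 (proof)] -/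
theorem commutator_sup_zpowers_pow_le (i : ℕ) :
    ⁅A ⊔ Subgroup.zpowers (g ^ p ^ i), A ⊔ Subgroup.zpowers (g ^ p ^ i)⁆ ≤
      liftSub A ((⊤ : Submodule ℤ (Additive A)).map (conjEnd A g ^ p ^ i - 1)) := by
  set u : G := g ^ p ^ i with hu
  set ψ : Module.End ℤ (Additive A) := conjEnd A u with hψ
  have hψ' : ψ = conjEnd A g ^ p ^ i := by rw [hψ, hu, conjEnd_pow'']
  -- `(ψ^k − 1) b ∈ (ψ − 1)A`
  have hmem : ∀ (k : ℕ) (b : Additive A), (conjEnd A (u ^ k) - 1) b ∈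
      (⊤ : Submodule ℤ (Additive A)).map (conjEnd A g ^ p ^ i - 1) := by
    intro k b
    rw [conjEnd_pow'', ← hψ, ← hψ']
    have hfac : ψ ^ k - 1 = (ψ - 1) * ∑ m ∈ range k, ψ ^ m := (mul_geom_sum ψ k).symm
    rw [hfac, Module.End.mul_apply]
    exact ⟨_, Submodule.mem_top, rfl⟩
  rw [Subgroup.commutator_le]
  intro x hx y hy
  obtain ⟨a, k, rfl⟩ := exists_eq_mul_pow_of_mem' (A := A) hx
  obtain ⟨b, l, rfl⟩ := exists_eq_mul_pow_of_mem' (A := A) hy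
  rw [commutatorElement_eq A a b ((Commute.refl u).pow_pow k l), toMul_mem_liftSub_iff']
  exact Submodule.sub_mem _ (hmem k (Additive.ofMul b)) (hmem l (Additive.ofMul a))

/-! ## §3 The coinvariant layer quotient -/

/-- **`(N_j·P_j·⁅G_i, G_j⁆) ∩ A ⊆ ν_j Y₀ + pA + (φ^{p^i} − 1)A`** for the layers `G_i ⊇ G_j ⊇ A` of indices `p^i`, `p^j` (`i ≤ j ≤ t`):
`N_j·P_j = (ν_jY₀ + pA)·⟨g^{p^j}⟩` (`commutator_sup_layer_pow_eq`), `⁅G_i, G_j⁆ ≤ ⁅G_i, G_i⁆ ⊆ (φ^{p^i} − 1)A` (`commutator_sup_zpowers_pow_le`,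
`G_i = A⟨g^{p^i}⟩` by `layer_eq_sup_zpowers`), and `⟨g^{p^j}⟩ ∩ A = 1`. [cite: Washington1997, §13.3 Lemmas 13.15 and 13.18]
[cite: Lang1990, Ch. 13 §4] -/
theorem commutator_sup_layer_pow_sup_commutator_inf_le (hgA : Subgroup.zpowers g ⊓ A = ⊥) (hgen : A ⊔ Subgroup.zpowers g = ⊤)
    (hind : A.index = p ^ t) (h𝓘 : ∀ I ∈ 𝓘, I ⊓ A = ⊥ ∧ (I = ⊥ ∨ I ⊔ A = ⊤)) (hg𝓘 : Subgroup.zpowers g ∈ 𝓘)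
    {i j : ℕ} (hij : i ≤ j) (hj : j ≤ t) {Gi Gj : Subgroup G} (hAGi : A ≤ Gi) (hGi : Gi.index = p ^ i)
    (hAGj : A ≤ Gj) (hGj : Gj.index = p ^ j) :
    (((⁅Gj, Gj⁆ ⊔ ⨆ I ∈ 𝓘, I ⊓ Gj) ⊔ Subgroup.closure ((fun x : G => x ^ p) '' (Gj : Set G))) ⊔ ⁅Gi, Gj⁆) ⊓ A ≤
      liftSub A (((subOf A (⁅(⊤ : Subgroup G), ⊤⁆ ⊔ ⨆ I ∈ 𝓘, I)).map (∑ m ∈ range (p ^ j), conjEnd A g ^ m) ⊔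
          (⊤ : Submodule ℤ (Additive A)).map ((p : ℤ) • (1 : Module.End ℤ (Additive A)))) ⊔
        (⊤ : Submodule ℤ (Additive A)).map (conjEnd A g ^ p ^ i - 1)) := by
  set Y : Submodule ℤ (Additive A) := subOf A (⁅(⊤ : Subgroup G), ⊤⁆ ⊔ ⨆ I ∈ 𝓘, I) with hY
  set φ : Module.End ℤ (Additive A) := conjEnd A g with hφ
  set P : Submodule ℤ (Additive A) := (⊤ : Submodule ℤ (Additive A)).map ((p : ℤ) • (1 : Module.End ℤ (Additive A))) with hP
  set W : Submodule ℤ (Additive A) := (⊤ : Submodule ℤ (Additive A)).map (φ ^ p ^ i - 1) with hW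
  set V : Submodule ℤ (Additive A) := (Y.map (∑ m ∈ range (p ^ j), φ ^ m) ⊔ P) ⊔ W with hV
  -- `V` is `φ`-stable, so `liftSub V` is normal
  have hstabYP : ∀ y ∈ Y.map (∑ m ∈ range (p ^ j), φ ^ m) ⊔ P, conjEnd A g y ∈ Y.map (∑ m ∈ range (p ^ j), φ ^ m) ⊔ P := by
    intro y hy
    obtain ⟨w, hw, z, hz, rfl⟩ := Submodule.mem_sup.mp hy
    rw [map_add]
    refine Submodule.add_mem _ (Submodule.mem_sup_left (conjEnd_mem_map_subOf_commutator_sup hgA hgen hind h𝓘 hg𝓘 j hw))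
      (Submodule.mem_sup_right ?_)
    obtain ⟨u, -, rfl⟩ := Submodule.mem_map.mp hz
    refine Submodule.mem_map.mpr ⟨conjEnd A g u, Submodule.mem_top, ?_⟩
    rw [LinearMap.smul_apply, LinearMap.smul_apply, Module.End.one_apply, Module.End.one_apply, map_zsmul]
  have hstabW : ∀ y ∈ W, conjEnd A g y ∈ W := by
    intro y hy
    obtain ⟨u, -, rfl⟩ := Submodule.mem_map.mp hy
    refine Submodule.mem_map.mpr ⟨φ u, Submodule.mem_top, ?_⟩
    have hcomm : φ * (φ ^ p ^ i - 1) = (φ ^ p ^ i - 1) * φ := by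
      rw [mul_sub, sub_mul, mul_one, one_mul, ← pow_succ', ← pow_succ]
    rw [← hφ, ← Module.End.mul_apply, ← hcomm, Module.End.mul_apply]
  have hstabV : ∀ y ∈ V, conjEnd A g y ∈ V := by
    intro y hy
    obtain ⟨w, hw, z, hz, rfl⟩ := Submodule.mem_sup.mp hy
    rw [map_add]
    exact Submodule.add_mem _ (Submodule.mem_sup_left (hstabYP w hw)) (Submodule.mem_sup_right (hstabW z hz))
  haveI : (liftSub A V).Normal := liftSub_normal' hgen hstabV
  have hgjA : Subgroup.zpowers (g ^ p ^ j) ⊓ A = ⊥ := by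
    rw [eq_bot_iff, ← hgA]
    exact inf_le_inf_right A ((Subgroup.zpowers_le).mpr (Subgroup.npow_mem_zpowers g _))
  -- the three pieces
  have hNP : (⁅Gj, Gj⁆ ⊔ ⨆ I ∈ 𝓘, I ⊓ Gj) ⊔ Subgroup.closure ((fun x : G => x ^ p) '' (Gj : Set G)) ≤
      liftSub A V ⊔ Subgroup.zpowers (g ^ p ^ j) := by
    rw [commutator_sup_layer_pow_eq hgA hgen hind h𝓘 hg𝓘 hj hAGj hGj]
    exact sup_le (le_sup_of_le_left (liftSub_mono' A le_sup_left)) le_sup_right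
  have hGieq : Gi = A ⊔ Subgroup.zpowers (g ^ p ^ i) := layer_eq_sup_zpowers hgA hgen hind (hij.trans hj) hAGi hGi
  have hGjeq : Gj = A ⊔ Subgroup.zpowers (g ^ p ^ j) := layer_eq_sup_zpowers hgA hgen hind hj hAGj hGj
  have hGjGi : Gj ≤ Gi := by
    rw [hGieq, hGjeq]
    refine sup_le le_sup_left ((Subgroup.zpowers_le).mpr (Subgroup.mem_sup_right ?_))
    rw [show p ^ j = p ^ i * p ^ (j - i) by rw [← pow_add, Nat.add_sub_cancel' hij], pow_mul]
    exact Subgroup.npow_mem_zpowers _ _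
  have hC : ⁅Gi, Gj⁆ ≤ liftSub A V := by
    refine (Subgroup.commutator_mono le_rfl hGjGi).trans ?_
    rw [hGieq]
    exact (commutator_sup_zpowers_pow_le (A := A) (g := g) (p := p) i).trans (liftSub_mono' A le_sup_right)
  -- assemble
  calc (((⁅Gj, Gj⁆ ⊔ ⨆ I ∈ 𝓘, I ⊓ Gj) ⊔ Subgroup.closure ((fun x : G => x ^ p) '' (Gj : Set G))) ⊔ ⁅Gi, Gj⁆) ⊓ A
      ≤ (liftSub A V ⊔ Subgroup.zpowers (g ^ p ^ j)) ⊓ A :=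
        inf_le_inf_right A (sup_le hNP (hC.trans le_sup_left))
    _ = liftSub A V := liftSub_sup_zpowers_inf_eq' hgjA V

/-- **`#(A/(ν_j Y₀ + pA + (φ^{p^i} − 1)A)) ≤ [G_j : N_j·P_j·⁅G_i, G_j⁆]`** (`i ≤ j ≤ t`): the coinvariant layer quotient of the
number-field side dominates the module quotient `X̄/T^{p^i}X̄` of the algebra side. [cite: Washington1997, §13.3 Lemmas 13.15 and 13.18, Prop. 13.22]
[cite: Lang1990, Ch. 13 §4] -/
theorem card_quotient_le_relIndex_commutator_sup_layer_pow_sup_commutator (hgA : Subgroup.zpowers g ⊓ A = ⊥)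
    (hgen : A ⊔ Subgroup.zpowers g = ⊤) (hind : A.index = p ^ t) (h𝓘 : ∀ I ∈ 𝓘, I ⊓ A = ⊥ ∧ (I = ⊥ ∨ I ⊔ A = ⊤))
    (hg𝓘 : Subgroup.zpowers g ∈ 𝓘) {i j : ℕ} (hij : i ≤ j) (hj : j ≤ t) {Gi Gj : Subgroup G} (hAGi : A ≤ Gi) (hGi : Gi.index = p ^ i)
    (hAGj : A ≤ Gj) (hGj : Gj.index = p ^ j) :
    Nat.card (Additive A ⧸ (((subOf A (⁅(⊤ : Subgroup G), ⊤⁆ ⊔ ⨆ I ∈ 𝓘, I)).map (∑ m ∈ range (p ^ j), conjEnd A g ^ m) ⊔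
          (⊤ : Submodule ℤ (Additive A)).map ((p : ℤ) • (1 : Module.End ℤ (Additive A)))) ⊔
        (⊤ : Submodule ℤ (Additive A)).map (conjEnd A g ^ p ^ i - 1))) ≤
      (((⁅Gj, Gj⁆ ⊔ ⨆ I ∈ 𝓘, I ⊓ Gj) ⊔ Subgroup.closure ((fun x : G => x ^ p) '' (Gj : Set G))) ⊔ ⁅Gi, Gj⁆).relIndex Gj := by
  set V : Submodule ℤ (Additive A) := ((subOf A (⁅(⊤ : Subgroup G), ⊤⁆ ⊔ ⨆ I ∈ 𝓘, I)).map (∑ m ∈ range (p ^ j), conjEnd A g ^ m) ⊔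
      (⊤ : Submodule ℤ (Additive A)).map ((p : ℤ) • (1 : Module.End ℤ (Additive A)))) ⊔
    (⊤ : Submodule ℤ (Additive A)).map (conjEnd A g ^ p ^ i - 1) with hV
  set C : Subgroup G := ((⁅Gj, Gj⁆ ⊔ ⨆ I ∈ 𝓘, I ⊓ Gj) ⊔ Subgroup.closure ((fun x : G => x ^ p) '' (Gj : Set G))) ⊔ ⁅Gi, Gj⁆
    with hC
  have hle : C ⊓ A ≤ liftSub A V :=
    commutator_sup_layer_pow_sup_commutator_inf_le hgA hgen hind h𝓘 hg𝓘 hij hj hAGi hGi hAGj hGj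
  have hGjeq := layer_eq_sup_zpowers hgA hgen hind hj hAGj hGj
  -- `C ≤ G_j` and `A ⊔ C = G_j`
  have hNjGj : ⁅Gj, Gj⁆ ⊔ ⨆ I ∈ 𝓘, I ⊓ Gj ≤ Gj := by
    refine sup_le ?_ (iSup₂_le fun I _ => inf_le_right)
    rw [Subgroup.commutator_le]
    exact fun x hx y hy => Gj.mul_mem (Gj.mul_mem (Gj.mul_mem hx hy) (Gj.inv_mem hx)) (Gj.inv_mem hy)
  have hPjGj : Subgroup.closure ((fun x : G => x ^ p) '' (Gj : Set G)) ≤ Gj := by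
    rw [Subgroup.closure_le]
    rintro _ ⟨x, hx, rfl⟩
    exact Gj.pow_mem hx p
  have hcommA : ⁅Gi, Gj⁆ ≤ A := by
    rw [Subgroup.commutator_le]
    intro x _ y _
    obtain ⟨a, m, rfl⟩ := exists_eq_mul_pow_of_mem' (A := A) (h := g) (by rw [hgen]; exact Subgroup.mem_top x)
    obtain ⟨b, n, rfl⟩ := exists_eq_mul_pow_of_mem' (A := A) (h := g) (by rw [hgen]; exact Subgroup.mem_top y)
    rw [← QuotientGroup.eq_one_iff, commutatorElement_def]
    simp only [QuotientGroup.mk_mul, QuotientGroup.mk_inv, (QuotientGroup.eq_one_iff (a : G)).mpr a.2,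
      (QuotientGroup.eq_one_iff (b : G)).mpr b.2, one_mul, QuotientGroup.mk_pow]
    rw [← zpow_natCast, ← zpow_natCast]
    group
  have hCGj : C ≤ Gj := sup_le (sup_le hNjGj hPjGj) (hcommA.trans hAGj)
  have hsup : A ⊔ C = Gj := by
    apply le_antisymm (sup_le hAGj hCGj)
    have h1 : g ^ p ^ j ∈ Subgroup.zpowers g ⊓ Gj :=
      ⟨Subgroup.npow_mem_zpowers g _, hGjeq ▸ Subgroup.mem_sup_right (Subgroup.mem_zpowers _)⟩
    have h2 : g ^ p ^ j ∈ ⁅Gj, Gj⁆ ⊔ ⨆ I ∈ 𝓘, I ⊓ Gj :=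
      le_sup_of_le_right (le_iSup₂ (f := fun I (_ : I ∈ 𝓘) => I ⊓ Gj) _ hg𝓘) h1
    calc Gj = A ⊔ Subgroup.zpowers (g ^ p ^ j) := hGjeq
      _ ≤ _ := sup_le le_sup_left ((Subgroup.zpowers_le).mpr
          (Subgroup.mem_sup_right (Subgroup.mem_sup_left (Subgroup.mem_sup_left h2))))
  -- `[G_j : C] · #(C ∩ A) = #A = #(A/V) · #V` and `#(C ∩ A) ≤ #V`
  have hmul := relIndex_mul_card_inf_eq'' (A := A) hCGj hAGj hsup
  have hCA : Nat.card ↥(C ⊓ A) ≤ Nat.card V := by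
    rw [← card_liftSub'' A V]
    exact Nat.card_le_card_of_injective (Subgroup.inclusion hle) (Subgroup.inclusion_injective hle)
  have hcard : Nat.card A = Nat.card (Additive A ⧸ V) * Nat.card V := by
    rw [mul_comm]; exact Submodule.card_eq_card_quotient_mul_card V
  have hApos : 0 < Nat.card ↥(C ⊓ A) := Nat.card_pos
  have h1 : Nat.card (Additive A ⧸ V) * Nat.card ↥(C ⊓ A) ≤ C.relIndex Gj * Nat.card ↥(C ⊓ A) := by
    calc Nat.card (Additive A ⧸ V) * Nat.card ↥(C ⊓ A) ≤ Nat.card (Additive A ⧸ V) * Nat.card V :=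
          Nat.mul_le_mul_left _ hCA
      _ = Nat.card A := hcard.symm
      _ = C.relIndex Gj * Nat.card ↥(C ⊓ A) := hmul.symm
  exact Nat.le_of_mul_le_mul_right h1 hApos

end Layers

end Literature.NumberTheory.IwasawaTheory.FukudaGroup

end
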